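import Summits.QuantumFields.BalabanUV.Beta.GAN24.DirichletRingEnergies

/-!
# `BalabanUV.Beta.GAN24.DirichletRingCutoff` — binder row G-an2-4 / (CONV-C), road P2 PART IV, leaf L11 in MODEL coordinates: A LATTICE-`C^{1,1}`
# RING CUT-OFF (quadratic smoothstep profile, separable in the two half-indices) AND THE COMMUTATOR `Δ(χU) − χΔU`
# (unit b2b-balaban-gan24-p2, gen 25, v1)

HONEST FRAMING (cell contract, verbatim): «discharging `BetaPertH` makes Bałaban's UV stability UNCONDITIONAL — a real constructive-QFT
result; it is NOT the continuum limit and NOT the Clay problem.»  Leaf L11 of memo `HOME/b2b-balaban-gan24-p2/gen24/W-FULL-WEIGHTED.md` §3 in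
MODEL COORDINATES (the dyadic (A)-assembly, L12, needs cut-offs whose FIRST differences are `O(1/L)` AND whose SECOND differences are `O(1/L²)`
— a piecewise-linear cut-off in the ring index loses a factor `L` at its kinks and along the diagonals of the sup-norm; see
`HOME/b2b-balaban-gan24-p2/gen25/RING-LEMMA-KERNEL.md` §6):
 * §1 `prof L t` — the quadratic smoothstep in one integer variable `t ≥ 0` at scale `L ≥ 1`: `0` for `t ≤ 2L`, `(t−2L)²/(2L²)` on `[2L,3L]`,
   `1 − (4L−t)²/(2L²)` on `[3L,4L]`, `1` for `t ≥ 4L`; piece lemmas; `0 ≤ prof ≤ 1`; **`abs_prof_sub_le`** `|δ prof| ≤ 1/L`;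
   **`abs_prof_dd_le`** `|δ² prof| ≤ 1/L²`;
 * §2 `tIdx i` — the half-index of a lattice coordinate (`i+1` for `i ≥ 0`, `−i` for `i < 0`, so `Q_k = {tIdx ≤ k}²`); `eta L i = prof L (tIdx i)`
   with the same two bounds along `i ↦ i+1`;
 * §3 `abs_sub_mul_le`/`abs_dd_mul_le` — discrete product rules: `|δ(fg)| ≤ α+β`, `|δ²(fg)| ≤ α² + 2αβ + β²` for `|f|,|g| ≤ 1`;
 * §4 `commutator_eq`/`norm_commutator_sq_le` — for ANY real cut-off `χ` and field `U`:
   `Δ(χU)(x) − χ(x)ΔU(x) = −Σ_± (χ(x±e_μ) − χ(x))(U(x±e_μ) − U(x)) − U(x)·Σ_μ δ_μ²χ(x)`, hence with `|δχ| ≤ α`, `|δ²_μχ| ≤ β` at `x`: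
   `‖Δ(χU)(x) − χ(x)ΔU(x)‖² ≤ 8α²·Σ_{y∼x}‖U(y) − U(x)‖² + 8β²‖U(x)‖²`.
The 2-D ring cut-off itself (`1 − (1−η_L(i))(1−η_L(j))` times an outer factor at scale `5L`) and its window bookkeeping are the consumer's (L12).

ABSOLUTE RULE (cell, verbatim): «No internally-minted statement may enter as a cited fact. Every hypothesis is either kernel-proved in
this package or a verbatim quotation of a PUBLISHED theorem with page reference. The manuscript(s) under audit are NOT citable for
their own disputed steps — they are the thing under adjudication; programme-internal (2001/route/tribunal) claims are never citable.»
[folklore] elementary; nothing printed is a hypothesis.  NOT CLAIMED: (A)/(B), NE2, (CONV-C), `BetaPertH`, continuum, Clay.  «not in print; our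
proof attempt».  HONEST DEPENDENCY: continuum YM on T⁴ ⇐ BetaPertH ∧ nine spine estimates (0/9 proved); BetaPertH ⇐ (D1) ∧ (D4) ∧ CAP+tail;
G-an2-4 gates asym, D1 and NE2/3/4.
-/

noncomputable section

open scoped BigOperators ComplexConjugate
open Finset

namespace Summit.QuantumFields.BalabanUV.Beta.GAN24.DirichletRingCutoff

open DirichletRingEnergies (lap)

/-! ## §1 The quadratic smoothstep profile -/

/-- the quadratic smoothstep at scale `L` in the integer variable `t`. [folklore] -/
def prof (L : ℕ) (t : ℤ) : ℝ :=
  if t ≤ 2 * (L : ℤ) then 0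
  else if t ≤ 3 * (L : ℤ) then ((t : ℝ) - 2 * L) ^ 2 / (2 * (L : ℝ) ^ 2)
  else if t ≤ 4 * (L : ℤ) then 1 - (4 * (L : ℝ) - t) ^ 2 / (2 * (L : ℝ) ^ 2)
  else 1

variable {L : ℕ}

/-- piece 1: `prof = 0` for `t ≤ 2L`. [folklore] -/
theorem prof_of_le_two {t : ℤ} (h : t ≤ 2 * (L : ℤ)) : prof L t = 0 := by
  unfold prof; rw [if_pos h]

/-- piece 2 (closed): `prof = (t−2L)²/(2L²)` for `2L ≤ t ≤ 3L`. [folklore] -/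
theorem prof_piece₂ {t : ℤ} (h1 : 2 * (L : ℤ) ≤ t) (_h2 : t ≤ 3 * (L : ℤ)) :
    prof L t = ((t : ℝ) - 2 * L) ^ 2 / (2 * (L : ℝ) ^ 2) := by
  unfold prof
  split_ifs with h
  · have : (t : ℝ) = 2 * L := by exact_mod_cast le_antisymm h h1
    rw [this]; simp
  · rfl

/-- piece 3 (closed): `prof = 1 − (4L−t)²/(2L²)` for `3L ≤ t ≤ 4L`. [folklore] -/
theorem prof_piece₃ (hL : 1 ≤ L) {t : ℤ} (h1 : 3 * (L : ℤ) ≤ t) (_h2 : t ≤ 4 * (L : ℤ)) :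
    prof L t = 1 - (4 * (L : ℝ) - t) ^ 2 / (2 * (L : ℝ) ^ 2) := by
  have hL0 : (0 : ℝ) < L := by exact_mod_cast hL
  unfold prof
  split_ifs with h h'
  · exfalso; omega
  · have : (t : ℝ) = 3 * L := by exact_mod_cast le_antisymm h' h1
    rw [this]; field_simp; ring
  · rfl

/-- piece 4: `prof = 1` for `4L ≤ t`. [folklore] -/
theorem prof_of_ge_four (hL : 1 ≤ L) {t : ℤ} (h : 4 * (L : ℤ) ≤ t) : prof L t = 1 := by
  unfold prof
  split_ifs with h1 h2 h3
  · exfalso; omega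
  · exfalso; omega
  · have : (t : ℝ) = 4 * L := by exact_mod_cast le_antisymm h3 h
    rw [this]; simp
  · rfl

/-- `0 ≤ prof ≤ 1`. [folklore] -/
theorem prof_mem (hL : 1 ≤ L) (t : ℤ) : 0 ≤ prof L t ∧ prof L t ≤ 1 := by
  have hL0 : (0 : ℝ) < L := by exact_mod_cast hL
  have hL2 : (0 : ℝ) < 2 * (L : ℝ) ^ 2 := by positivity
  rcases le_or_gt t (2 * (L : ℤ)) with h | h
  · rw [prof_of_le_two h]; norm_num
  rcases le_or_gt t (3 * (L : ℤ)) with h' | h'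
  · rw [prof_piece₂ h.le h']
    have h1 : (2 * (L : ℝ)) ≤ t := by exact_mod_cast h.le
    have h2 : (t : ℝ) ≤ 3 * L := by exact_mod_cast h'
    constructor
    · positivity
    · rw [div_le_one hL2]; nlinarith
  rcases le_or_gt t (4 * (L : ℤ)) with h'' | h''
  · rw [prof_piece₃ hL h'.le h'']
    have h1 : (3 * (L : ℝ)) ≤ t := by exact_mod_cast h'.le
    have h2 : (t : ℝ) ≤ 4 * L := by exact_mod_cast h''
    constructor
    · rw [sub_nonneg, div_le_one hL2]; nlinarith
    · have : 0 ≤ (4 * (L : ℝ) - t) ^ 2 / (2 * (L : ℝ) ^ 2) := by positivity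
      linarith
  · rw [prof_of_ge_four hL h''.le]; norm_num

/-- **first differences**: `|prof(t+1) − prof(t)| ≤ 1/L`. [folklore] -/
theorem abs_prof_sub_le (hL : 1 ≤ L) (t : ℤ) : |prof L (t + 1) - prof L t| ≤ 1 / (L : ℝ) := by
  have hL0 : (0 : ℝ) < L := by exact_mod_cast hL
  have hL1 : (1 : ℝ) ≤ L := by exact_mod_cast hL
  have hL2 : (0 : ℝ) < 2 * (L : ℝ) ^ 2 := by positivity
  rw [abs_le]
  have hinv : 0 < 1 / (L : ℝ) := one_div_pos.mpr hL0
  have e22 : 1 / (L : ℝ) * (2 * (L : ℝ) ^ 2) = 2 * L := by field_simp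
  rcases le_or_gt (t + 1) (2 * (L : ℤ)) with h | h
  · rw [prof_of_le_two h, prof_of_le_two (by omega)]
    constructor <;> linarith
  rcases le_or_gt (t + 1) (3 * (L : ℤ)) with h' | h'
  · -- both in piece 2 (t ≥ 2L)
    rw [prof_piece₂ (by omega) h', prof_piece₂ (by omega) (by omega)]
    have h1 : (2 * (L : ℝ)) ≤ t := by exact_mod_cast (show 2 * (L : ℤ) ≤ t by omega)
    have h2 : (t : ℝ) + 1 ≤ 3 * L := by exact_mod_cast h'
    push_cast
    rw [← sub_div, le_div_iff₀ hL2, div_le_iff₀ hL2, e22,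
      show ((t : ℝ) + 1 - 2 * L) ^ 2 - ((t : ℝ) - 2 * L) ^ 2 = 2 * ((t : ℝ) - 2 * L) + 1 by ring]
    constructor <;> nlinarith
  rcases le_or_gt (t + 1) (4 * (L : ℤ)) with h'' | h''
  · -- both in piece 3 (t ≥ 3L)
    rw [prof_piece₃ hL (by omega) h'', prof_piece₃ hL (by omega) (by omega)]
    have h1 : (3 * (L : ℝ)) ≤ t := by exact_mod_cast (show 3 * (L : ℤ) ≤ t by omega)
    have h2 : (t : ℝ) + 1 ≤ 4 * L := by exact_mod_cast h''
    push_cast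
    rw [show (1 - (4 * (L : ℝ) - (t + 1)) ^ 2 / (2 * (L : ℝ) ^ 2)) - (1 - (4 * (L : ℝ) - t) ^ 2 / (2 * (L : ℝ) ^ 2))
        = (2 * (4 * (L : ℝ) - t) - 1) / (2 * (L : ℝ) ^ 2) by field_simp; ring]
    rw [le_div_iff₀ hL2, div_le_iff₀ hL2, e22]
    constructor <;> nlinarith
  · rw [prof_of_ge_four hL h''.le, prof_of_ge_four hL (by omega)]
    constructor <;> linarith

/-- **second differences**: `|prof(t+1) − 2prof(t) + prof(t−1)| ≤ 1/L²`. [folklore] -/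
theorem abs_prof_dd_le (hL : 1 ≤ L) (t : ℤ) : |prof L (t + 1) - 2 * prof L t + prof L (t - 1)| ≤ 1 / (L : ℝ) ^ 2 := by
  have hL0 : (0 : ℝ) < L := by exact_mod_cast hL
  have hL1 : (1 : ℝ) ≤ L := by exact_mod_cast hL
  have hL2 : (0 : ℝ) < 2 * (L : ℝ) ^ 2 := by positivity
  have hLL : (0 : ℝ) < (L : ℝ) ^ 2 := by positivity
  have hinv : 0 < 1 / (L : ℝ) ^ 2 := by positivity
  rw [abs_le]
  -- (a) all three below 2L
  rcases le_or_gt (t + 1) (2 * (L : ℤ)) with h | h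
  · rw [prof_of_le_two h, prof_of_le_two (by omega), prof_of_le_two (by omega)]
    constructor <;> linarith
  -- (b) t = 2L
  rcases eq_or_lt_of_le (show 2 * (L : ℤ) ≤ t by omega) with h0 | h0
  · rw [← h0, prof_piece₂ (t := 2 * (L : ℤ) + 1) (by omega) (by omega), prof_of_le_two (t := 2 * (L : ℤ)) le_rfl,
      prof_of_le_two (t := 2 * (L : ℤ) - 1) (by omega)]
    push_cast
    rw [show ((2 * (L : ℝ) + 1 - 2 * L) ^ 2 / (2 * (L : ℝ) ^ 2) - 2 * 0 + 0) = 1 / (2 * (L : ℝ) ^ 2) by ring]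
    constructor
    · linarith [show 0 < 1 / (2 * (L : ℝ) ^ 2) by positivity]
    · rw [div_le_div_iff₀ hL2 hLL]; nlinarith
  -- (c) 2L < t, t+1 ≤ 3L: all three in the closed piece 2
  rcases le_or_gt (t + 1) (3 * (L : ℤ)) with h' | h'
  · rw [prof_piece₂ (t := t + 1) (by omega) h', prof_piece₂ (t := t) (by omega) (by omega),
      prof_piece₂ (t := t - 1) (by omega) (by omega)]
    push_cast
    rw [show ((t : ℝ) + 1 - 2 * L) ^ 2 / (2 * (L : ℝ) ^ 2) - 2 * (((t : ℝ) - 2 * L) ^ 2 / (2 * (L : ℝ) ^ 2))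
        + ((t : ℝ) - 1 - 2 * L) ^ 2 / (2 * (L : ℝ) ^ 2) = 1 / (L : ℝ) ^ 2 by field_simp; ring]
    constructor <;> linarith
  -- (d) t = 3L
  rcases eq_or_lt_of_le (show 3 * (L : ℤ) ≤ t by omega) with h0 | h0
  · rw [← h0, prof_piece₃ hL (t := 3 * (L : ℤ) + 1) (by omega) (by omega), prof_piece₃ hL (t := 3 * (L : ℤ)) le_rfl (by omega),
      prof_piece₂ (t := 3 * (L : ℤ) - 1) (by omega) (by omega)]
    push_cast
    rw [show (1 - (4 * (L : ℝ) - (3 * L + 1)) ^ 2 / (2 * (L : ℝ) ^ 2)) - 2 * (1 - (4 * (L : ℝ) - 3 * L) ^ 2 / (2 * (L : ℝ) ^ 2))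
        + (3 * (L : ℝ) - 1 - 2 * L) ^ 2 / (2 * (L : ℝ) ^ 2) = 0 by field_simp; ring]
    constructor <;> linarith
  -- (e) 3L < t, t+1 ≤ 4L: all three in the closed piece 3
  rcases le_or_gt (t + 1) (4 * (L : ℤ)) with h'' | h''
  · rw [prof_piece₃ hL (t := t + 1) (by omega) h'', prof_piece₃ hL (t := t) (by omega) (by omega),
      prof_piece₃ hL (t := t - 1) (by omega) (by omega)]
    push_cast
    rw [show (1 - (4 * (L : ℝ) - (t + 1)) ^ 2 / (2 * (L : ℝ) ^ 2)) - 2 * (1 - (4 * (L : ℝ) - t) ^ 2 / (2 * (L : ℝ) ^ 2))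
        + (1 - (4 * (L : ℝ) - (t - 1)) ^ 2 / (2 * (L : ℝ) ^ 2)) = -(1 / (L : ℝ) ^ 2) by field_simp; ring]
    constructor <;> linarith
  -- (f) t = 4L
  rcases eq_or_lt_of_le (show 4 * (L : ℤ) ≤ t by omega) with h0 | h0
  · rw [← h0, prof_of_ge_four hL (t := 4 * (L : ℤ) + 1) (by omega), prof_of_ge_four hL (t := 4 * (L : ℤ)) le_rfl,
      prof_piece₃ hL (t := 4 * (L : ℤ) - 1) (by omega) (by omega)]
    push_cast
    rw [show (1 : ℝ) - 2 * 1 + (1 - (4 * (L : ℝ) - (4 * L - 1)) ^ 2 / (2 * (L : ℝ) ^ 2)) = -(1 / (2 * (L : ℝ) ^ 2)) by ring]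
    constructor
    · rw [neg_le_neg_iff, div_le_div_iff₀ hL2 hLL]; nlinarith
    · linarith [show 0 < 1 / (2 * (L : ℝ) ^ 2) by positivity]
  -- (g) all three ≥ 4L
  · rw [prof_of_ge_four hL h0.le, prof_of_ge_four hL (by omega), prof_of_ge_four hL (by omega)]
    constructor <;> linarith

/-! ## §2 The half-index and the profile along a lattice line -/

/-- the half-index: `tIdx i = i+1` for `i ≥ 0`, `−i` for `i < 0` (so that `[−k,k) = {tIdx ≤ k}`). [folklore] -/
def tIdx (i : ℤ) : ℤ := if 0 ≤ i then i + 1 else -i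

/-- `1 ≤ tIdx i`. [folklore] -/
theorem one_le_tIdx (i : ℤ) : 1 ≤ tIdx i := by unfold tIdx; split_ifs <;> omega

/-- the profile along a lattice line: `eta L i = prof L (tIdx i)`. [folklore] -/
def eta (L : ℕ) (i : ℤ) : ℝ := prof L (tIdx i)

/-- `0 ≤ eta ≤ 1`. [folklore] -/
theorem eta_mem (hL : 1 ≤ L) (i : ℤ) : 0 ≤ eta L i ∧ eta L i ≤ 1 := prof_mem hL _

/-- `eta = 0` on `tIdx ≤ 2L`. [folklore] -/
theorem eta_eq_zero {i : ℤ} (h : tIdx i ≤ 2 * (L : ℤ)) : eta L i = 0 := prof_of_le_two h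

/-- `eta = 1` on `4L ≤ tIdx`. [folklore] -/
theorem eta_eq_one (hL : 1 ≤ L) {i : ℤ} (h : 4 * (L : ℤ) ≤ tIdx i) : eta L i = 1 := prof_of_ge_four hL h

/-- **first differences of `eta`**: `|eta(i+1) − eta(i)| ≤ 1/L`. [folklore] -/
theorem abs_eta_sub_le (hL : 1 ≤ L) (i : ℤ) : |eta L (i + 1) - eta L i| ≤ 1 / (L : ℝ) := by
  have hL0 : (0 : ℝ) < L := by exact_mod_cast hL
  rcases le_or_gt 0 i with hi | hi
  · -- i ≥ 0: half-indices i+2, i+1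
    have e1 : tIdx (i + 1) = (i + 1) + 1 := by unfold tIdx; rw [if_pos (by omega)]
    have e2 : tIdx i = i + 1 := by unfold tIdx; rw [if_pos hi]
    unfold eta; rw [e1, e2]; exact abs_prof_sub_le hL (i + 1)
  rcases le_or_gt i (-2) with hi' | hi'
  · -- i ≤ -2: half-indices -(i+1), -i
    have e1 : tIdx (i + 1) = -i - 1 := by unfold tIdx; rw [if_neg (by omega)]; ring
    have e2 : tIdx i = -i - 1 + 1 := by unfold tIdx; rw [if_neg (by omega)]; ring
    unfold eta; rw [e1, e2, abs_sub_comm]; exact abs_prof_sub_le hL (-i - 1)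
  · -- i = -1: both half-indices are 1
    have hi1 : i = -1 := by omega
    subst hi1
    have e1 : tIdx (-1 + 1) = 1 := by unfold tIdx; rw [if_pos (by omega)]; ring
    have e2 : tIdx (-1) = 1 := by unfold tIdx; rw [if_neg (by omega)]; ring
    unfold eta; rw [e1, e2, sub_self, abs_zero]; positivity

/-- **second differences of `eta`**: `|eta(i+1) − 2eta(i) + eta(i−1)| ≤ 1/L²`. [folklore] -/
theorem abs_eta_dd_le (hL : 1 ≤ L) (i : ℤ) : |eta L (i + 1) - 2 * eta L i + eta L (i - 1)| ≤ 1 / (L : ℝ) ^ 2 := by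
  have hL0 : (0 : ℝ) < L := by exact_mod_cast hL
  have hpos : 0 ≤ 1 / (L : ℝ) ^ 2 := by positivity
  rcases le_or_gt 1 i with hi | hi
  · -- i ≥ 1: half-indices i+2, i+1, i
    have e1 : tIdx (i + 1) = (i + 1) + 1 := by unfold tIdx; rw [if_pos (by omega)]
    have e2 : tIdx i = i + 1 := by unfold tIdx; rw [if_pos (by omega)]
    have e3 : tIdx (i - 1) = (i + 1) - 1 := by unfold tIdx; rw [if_pos (by omega)]; ring
    unfold eta; rw [e1, e2, e3]; exact abs_prof_dd_le hL (i + 1)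
  rcases le_or_gt i (-2) with hi' | hi'
  · -- i ≤ -2: half-indices -(i+1), -i, -(i-1) = reversed consecutive around -i
    have e1 : tIdx (i + 1) = -i - 1 := by unfold tIdx; rw [if_neg (by omega)]; ring
    have e2 : tIdx i = -i := by unfold tIdx; rw [if_neg (by omega)]
    have e3 : tIdx (i - 1) = -i + 1 := by unfold tIdx; rw [if_neg (by omega)]; ring
    unfold eta; rw [e1, e2, e3]
    have h := abs_prof_dd_le hL (-i)
    have e : prof L (-i - 1) - 2 * prof L (-i) + prof L (-i + 1) = prof L (-i + 1) - 2 * prof L (-i) + prof L (-i - 1) := by ring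
    rw [e]; exact h
  · -- i ∈ {-1, 0}: all three half-indices ≤ 2 ≤ 2L
    have h1 : tIdx (i + 1) ≤ 2 := by unfold tIdx; split_ifs <;> omega
    have h2 : tIdx i ≤ 2 := by unfold tIdx; split_ifs <;> omega
    have h3 : tIdx (i - 1) ≤ 2 := by unfold tIdx; split_ifs <;> omega
    unfold eta
    rw [prof_of_le_two (by omega), prof_of_le_two (by omega), prof_of_le_two (by omega)]
    norm_num [hpos]

/-! ## §3 Discrete product rules -/

/-- **product rule, first difference**: `|f|,|g| ≤ 1`, `|δf| ≤ α`, `|δg| ≤ β` ⟹ `|δ(fg)| ≤ α + β`. [folklore] -/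
theorem abs_sub_mul_le {f g : ℤ → ℝ} {α β : ℝ} (hf : ∀ i, |f i| ≤ 1) (hg : ∀ i, |g i| ≤ 1)
    (hdf : ∀ i, |f (i + 1) - f i| ≤ α) (hdg : ∀ i, |g (i + 1) - g i| ≤ β) (i : ℤ) :
    |f (i + 1) * g (i + 1) - f i * g i| ≤ α + β := by
  have e : f (i + 1) * g (i + 1) - f i * g i = (f (i + 1) - f i) * g (i + 1) + f i * (g (i + 1) - g i) := by ring
  rw [e]
  refine (abs_add_le _ _).trans (add_le_add ?_ ?_)
  · rw [abs_mul]
    calc |f (i + 1) - f i| * |g (i + 1)| ≤ α * 1 := mul_le_mul (hdf i) (hg _) (abs_nonneg _) ((abs_nonneg _).trans (hdf i))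
      _ = α := mul_one α
  · rw [abs_mul]
    calc |f i| * |g (i + 1) - g i| ≤ 1 * β := mul_le_mul (hf i) (hdg i) (abs_nonneg _) zero_le_one
      _ = β := one_mul β

/-- **product rule, second difference**: `|f|,|g| ≤ 1`, `|δf| ≤ α`, `|δg| ≤ β`, `|δ²f| ≤ α'`, `|δ²g| ≤ β'` ⟹
`|δ²(fg)| ≤ α' + β' + 2αβ`. [folklore] -/
theorem abs_dd_mul_le {f g : ℤ → ℝ} {α β α' β' : ℝ} (hf : ∀ i, |f i| ≤ 1) (hg : ∀ i, |g i| ≤ 1)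
    (hdf : ∀ i, |f (i + 1) - f i| ≤ α) (hdg : ∀ i, |g (i + 1) - g i| ≤ β)
    (hddf : ∀ i, |f (i + 1) - 2 * f i + f (i - 1)| ≤ α') (hddg : ∀ i, |g (i + 1) - 2 * g i + g (i - 1)| ≤ β') (i : ℤ) :
    |f (i + 1) * g (i + 1) - 2 * (f i * g i) + f (i - 1) * g (i - 1)| ≤ α' + β' + 2 * (α * β) := by
  have hα : 0 ≤ α := (abs_nonneg _).trans (hdf 0)
  have e : f (i + 1) * g (i + 1) - 2 * (f i * g i) + f (i - 1) * g (i - 1)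
      = (f (i + 1) - 2 * f i + f (i - 1)) * g i + f i * (g (i + 1) - 2 * g i + g (i - 1))
        + ((f (i + 1) - f i) * (g (i + 1) - g i) + (f (i - 1) - f i) * (g (i - 1) - g i)) := by ring
  rw [e]
  have h1 : |(f (i + 1) - 2 * f i + f (i - 1)) * g i| ≤ α' := by
    rw [abs_mul]
    calc _ ≤ α' * 1 := mul_le_mul (hddf i) (hg i) (abs_nonneg _) ((abs_nonneg _).trans (hddf i))
      _ = α' := mul_one _
  have h2 : |f i * (g (i + 1) - 2 * g i + g (i - 1))| ≤ β' := by
    rw [abs_mul]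
    calc _ ≤ 1 * β' := mul_le_mul (hf i) (hddg i) (abs_nonneg _) zero_le_one
      _ = β' := one_mul _
  have h3 : |(f (i + 1) - f i) * (g (i + 1) - g i)| ≤ α * β := by
    rw [abs_mul]; exact mul_le_mul (hdf i) (hdg i) (abs_nonneg _) hα
  have h4 : |(f (i - 1) - f i) * (g (i - 1) - g i)| ≤ α * β := by
    rw [abs_mul, abs_sub_comm (f (i - 1)), abs_sub_comm (g (i - 1))]
    have hf' := hdf (i - 1); have hg' := hdg (i - 1)
    rw [sub_add_cancel] at hf' hg'
    exact mul_le_mul hf' hg' (abs_nonneg _) hα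
  calc _ ≤ |(f (i + 1) - 2 * f i + f (i - 1)) * g i + f i * (g (i + 1) - 2 * g i + g (i - 1))|
        + |(f (i + 1) - f i) * (g (i + 1) - g i) + (f (i - 1) - f i) * (g (i - 1) - g i)| := abs_add_le _ _
    _ ≤ (α' + β') + (α * β + α * β) :=
        add_le_add ((abs_add_le _ _).trans (add_le_add h1 h2)) ((abs_add_le _ _).trans (add_le_add h3 h4))
    _ = α' + β' + 2 * (α * β) := by ring

/-! ## §4 The commutator of the lattice Laplacian with a real cut-off -/

/-- **the commutator identity**: for a real cut-off `χ` and a field `U`, with `z = χ·U`,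
`Δz(x) − χ(x)ΔU(x) = −Σ_{±,μ}(χ(x±e_μ) − χ(x))(U(x±e_μ) − U(x)) − U(x)·(δ₁²χ(x) + δ₂²χ(x))`. [folklore] -/
theorem commutator_eq (χ : ℤ → ℤ → ℝ) (U : ℤ → ℤ → ℂ) (i j : ℤ) :
    lap (fun i j => (χ i j : ℂ) * U i j) i j - (χ i j : ℂ) * lap U i j
      = -(((χ (i + 1) j - χ i j : ℝ) : ℂ) * (U (i + 1) j - U i j) + ((χ (i - 1) j - χ i j : ℝ) : ℂ) * (U (i - 1) j - U i j)
          + ((χ i (j + 1) - χ i j : ℝ) : ℂ) * (U i (j + 1) - U i j) + ((χ i (j - 1) - χ i j : ℝ) : ℂ) * (U i (j - 1) - U i j))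
        - U i j * ((((χ (i + 1) j - 2 * χ i j + χ (i - 1) j) + (χ i (j + 1) - 2 * χ i j + χ i (j - 1)) : ℝ) : ℂ)) := by
  simp only [lap]
  push_cast
  ring

/-- **the commutator bound**: if at the site `x = (i,j)` the cut-off has `|χ(x±e_μ) − χ(x)| ≤ α` (all four neighbours) and
`|δ_μ²χ(x)| ≤ β` (both directions), then `‖Δ(χU)(x) − χ(x)ΔU(x)‖² ≤ 8α²·Σ_{y∼x}‖U(y) − U(x)‖² + 8β²‖U(x)‖²`. [folklore] -/
theorem norm_commutator_sq_le (χ : ℤ → ℤ → ℝ) (U : ℤ → ℤ → ℂ) (i j : ℤ) {α β : ℝ}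
    (h1 : |χ (i + 1) j - χ i j| ≤ α) (h2 : |χ (i - 1) j - χ i j| ≤ α) (h3 : |χ i (j + 1) - χ i j| ≤ α) (h4 : |χ i (j - 1) - χ i j| ≤ α)
    (h5 : |χ (i + 1) j - 2 * χ i j + χ (i - 1) j| ≤ β) (h6 : |χ i (j + 1) - 2 * χ i j + χ i (j - 1)| ≤ β) :
    ‖lap (fun i j => (χ i j : ℂ) * U i j) i j - (χ i j : ℂ) * lap U i j‖ ^ 2
      ≤ 8 * α ^ 2 * (‖U (i + 1) j - U i j‖ ^ 2 + ‖U (i - 1) j - U i j‖ ^ 2 + ‖U i (j + 1) - U i j‖ ^ 2 + ‖U i (j - 1) - U i j‖ ^ 2)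
        + 8 * β ^ 2 * ‖U i j‖ ^ 2 := by
  rw [commutator_eq]
  have hα : 0 ≤ α := (abs_nonneg _).trans h1
  have hβ : 0 ≤ β := (abs_nonneg _).trans h5
  -- the four transport terms and the potential term
  set a1 := ‖U (i + 1) j - U i j‖; set a2 := ‖U (i - 1) j - U i j‖
  set a3 := ‖U i (j + 1) - U i j‖; set a4 := ‖U i (j - 1) - U i j‖
  set u0 := ‖U i j‖
  have t1 : ‖((χ (i + 1) j - χ i j : ℝ) : ℂ) * (U (i + 1) j - U i j)‖ ≤ α * a1 := by
    rw [norm_mul, Complex.norm_real, Real.norm_eq_abs]; exact mul_le_mul_of_nonneg_right h1 (norm_nonneg _)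
  have t2 : ‖((χ (i - 1) j - χ i j : ℝ) : ℂ) * (U (i - 1) j - U i j)‖ ≤ α * a2 := by
    rw [norm_mul, Complex.norm_real, Real.norm_eq_abs]; exact mul_le_mul_of_nonneg_right h2 (norm_nonneg _)
  have t3 : ‖((χ i (j + 1) - χ i j : ℝ) : ℂ) * (U i (j + 1) - U i j)‖ ≤ α * a3 := by
    rw [norm_mul, Complex.norm_real, Real.norm_eq_abs]; exact mul_le_mul_of_nonneg_right h3 (norm_nonneg _)
  have t4 : ‖((χ i (j - 1) - χ i j : ℝ) : ℂ) * (U i (j - 1) - U i j)‖ ≤ α * a4 := by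
    rw [norm_mul, Complex.norm_real, Real.norm_eq_abs]; exact mul_le_mul_of_nonneg_right h4 (norm_nonneg _)
  have t5 : ‖U i j * ((((χ (i + 1) j - 2 * χ i j + χ (i - 1) j) + (χ i (j + 1) - 2 * χ i j + χ i (j - 1)) : ℝ) : ℂ))‖ ≤ u0 * (2 * β) := by
    rw [norm_mul, Complex.norm_real, Real.norm_eq_abs]
    refine mul_le_mul_of_nonneg_left ((abs_add_le _ _).trans ?_) (norm_nonneg _)
    linarith
  have htot : ‖-(((χ (i + 1) j - χ i j : ℝ) : ℂ) * (U (i + 1) j - U i j) + ((χ (i - 1) j - χ i j : ℝ) : ℂ) * (U (i - 1) j - U i j)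
          + ((χ i (j + 1) - χ i j : ℝ) : ℂ) * (U i (j + 1) - U i j) + ((χ i (j - 1) - χ i j : ℝ) : ℂ) * (U i (j - 1) - U i j))
        - U i j * ((((χ (i + 1) j - 2 * χ i j + χ (i - 1) j) + (χ i (j + 1) - 2 * χ i j + χ i (j - 1)) : ℝ) : ℂ))‖
      ≤ α * (a1 + a2 + a3 + a4) + u0 * (2 * β) := by
    refine (norm_sub_le _ _).trans (add_le_add ?_ t5)
    rw [norm_neg]
    refine (norm_add_le _ _).trans ?_
    have h12 := (norm_add_le _ _).trans (add_le_add ((norm_add_le _ _).trans (add_le_add t1 t2)) t3)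
    linarith [t4]
  have h0 : 0 ≤ α * (a1 + a2 + a3 + a4) + u0 * (2 * β) := by positivity
  calc _ ≤ (α * (a1 + a2 + a3 + a4) + u0 * (2 * β)) ^ 2 := pow_le_pow_left₀ (norm_nonneg _) htot 2
    _ ≤ 8 * α ^ 2 * (a1 ^ 2 + a2 ^ 2 + a3 ^ 2 + a4 ^ 2) + 8 * β ^ 2 * u0 ^ 2 := by
        nlinarith [sq_nonneg (α * (a1 + a2 + a3 + a4) - u0 * (2 * β)), sq_nonneg (a1 - a2), sq_nonneg (a1 - a3), sq_nonneg (a1 - a4),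
          sq_nonneg (a2 - a3), sq_nonneg (a2 - a4), sq_nonneg (a3 - a4), sq_nonneg α]

end Summit.QuantumFields.BalabanUV.Beta.GAN24.DirichletRingCutoff

end
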